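import Literature.MathematicalPhysics.QuantumFieldTheory.Balaban1983to89.T4TreeGaugeFixing

/-!
# `T4Continuum.ShellMeasureAxialReach` — (LR)₀, configuration level: a configuration TRIVIAL ON THE AXIAL COMB of a
# box whose box plaquettes are small has every box bond small, hence (for `SU(2)`) inside ONE exponential window
# about `1` — the reach lemma behind the window insertion of the realized (M1)₀
# (cell `pub-balaban`, sub-cell `t4`, spine estimate NE7c (node U5b); lineage t4-ne7c-p1 = PROVER seat P1
# «shell-measure route», generation 26; seat S1 of the lineage's ROUND-2 skeleton `t4/skeletons/NE7c-t4-ne7c-p1.md`;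
# ADDITIVE — imports the tree's `T4TreeGaugeFixing` only (hence `T4AxialGaugeFixing`, `T4AxialGaugeSmallField`,
# `B8Lemma1NonAbelian`, `B7Prop1Explicit`, `T4ExpWindowSmallField`), all used BY NAME, nothing re-proved or modified)

HONEST FRAMING.  Finite four-torus programme, rung (B)+1 only — NOT infinite volume, NOT a mass gap, NOT the Clay
problem, NOT summit progress; (B), `BetaPertHyp`, (B^μ) not consumed.  (M1) for BAŁABAN'S INDUCTIVELY DEFINED
EFFECTIVE MEASURES is NOT PRINTED (GAPS G-ne7cp1-1), asserted by nobody, and NOT moved here.  This file is GEOMETRY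
ONLY (no measure, no estimate of the programme): it supplies the configuration-level fact the realized level-0 headline
`ShellMeasureWilsonRealizedSU2.slotAntiConcentration_wilson_su2` (p206694) ASSUMED in the form of its weight — the bond
window on the block («(LR)₀ assumed as the window») — from PLAQUETTE smallness after the tree (axial) gauge, so that
the companion module `ShellMeasureWilsonGaugeInvariant` can state (M1)₀ for a GAUGE-INVARIANT density with plaquette
co-tests and no bond window.  0 sorry, 0 citations.  HONEST DEPENDENCY (cell): continuum YM on T⁴ ⇐ BetaPertH ∧ nine
spine estimates (0/9 proved); BetaPertH ⇐ (D1) ∧ (D4) ∧ CAP+tail; G-an2-4 gates asym, D1 and NE2/3/4.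

THE POINT.  `T4AxialGaugeSmallField` (lineage pv26) proves the torus non-abelian Poincaré lemma for the axial-gauge COPY
`U^{axialGauge}` of a configuration: plaquette-small on a non-wrapping box ⟹ bond-small on the box.  The tree-gauge
transport of (M1) (`ShellMeasureScalingLocal.slotAntiConcentration_gaugeFixed_iff`, via `T4TreeGaugeFixing`) does
not produce a gauge copy but the SUBSTITUTED configuration `U[comb := 1]` (`fixTo (combBonds lo hi) 1 U`).  The
missing link is elementary and is proved here: a configuration that is ALREADY `1` on the comb has trivial axial
gauge function on the box (the tree contour `Γ_{lo,x}` of [Balaban1985Averaging] p. 24 walks comb bonds only —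
`axialFn_eq_one_of_comb`), so the sharp tree-gauge bound applies to the configuration ITSELF.

## What is proved

§1 (`ℤ^d`, any group) `hol_seg_eq_one`, `hol_tw_eq_one` (a tree word all of whose bonds read `1` has trivial
holonomy — induction along the direction list `d−1, …, 0`), `axialFn_eq_one_of_comb`, `gaugeAct_axialFn_eq_self_of_comb`;
(any `GaugeGroup`) `dist1_le_sharp_of_comb` / `dist1_le_uniform_of_comb`: under `BoxPlaqSmall V lo hi a` a comb-trivial
`V` has `dist1 (V(x, x+e_μ)) ≤ (Σ_{κ<μ}|x_κ − lo_κ|)·a ≤ (d − 1)·n·a` on the box (`hi ≤ lo + n`).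
§2 (torus carrier of `Setup`) `pull_eq_one_of_comb`, `dist1_le_of_comb` / `dist1_le_of_comb_of_mem_boxBonds`: a torus
configuration equal to `1` on `combBonds lo hi` with `dist1 U(∂p) < a` on `boxPlaqs lo hi` has `dist1 (U b) ≤ (d−1)·n·a`
on `boxBonds lo hi`; `fixTo_comb_eq_one` (the substituted configuration is comb-trivial).  NO non-wrapping hypothesis
is needed at this level (the estimate runs on the periodic pullback).
§3 (`SU(2)`) `mem_expWindow_of_comb`, `expWindowDensity_eq_one_of_comb`, `expWindowDensity_fixTo_comb_eq_one`: with
`0 ≤ S` and `(d − 1)·n·a ≤ 2S/π` every box bond lies in `expWindow 1 S` and the product window density over any finite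
set of box bonds takes the value `1` — for the configuration itself, in particular for `U[comb := 1]`.

## Caveats

* Configuration level only; the measure-level use (tree gauge = `T4TreeGaugeFixing`, loop-freeness of the comb =
  `noClosedLoop_combBonds`, which DOES need the non-wrapping hypothesis) is in the companion module.
* Corner-rooted comb with the direction order of `B7Prop1Explicit.treeWord`; constants not optimised.
* Nothing here is specific to level `0` of Bałaban's induction except its use: at a live level the tested variables
  are plaquette functionals of the localized MINIMISER, not of the integration variables (G-ne7cp1-14), and no reach
  lemma for those is claimed.
-/

noncomputable section

open Set

namespace Summit.QuantumFields.BalabanUV.T4Continuum.ShellMeasureAxialReach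

open Literature.MathematicalPhysics.QuantumFieldTheory.Balaban1983to89
open B7Prop1Explicit (Letter e e_apply disp disp_seg hol hol_nil hol_append seg seg_zero hol_seg_natCast_succ
  gaugeAct axialFn treeWord l1)
open B8Lemma1NonAbelian (lowPart lowPart_apply zsmul_e_apply e_nonneg tw tw_nil tw_cons treeWord_eq_tw
  pairwise_gt_finRange_reverse)
open T4AxialGaugeSmallField (BoxPlaqSmall dist1_axial_bond_le_sharp dist1_axial_bond_le_uniform castSite pull
  pull_apply boxPlaqs boxBonds boxPlaqSmall_pull)
open T4AxialGaugeFixing (combBonds combSet mem_combBonds)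
open T4TreeGaugeFixing (fixTo fixTo_apply_of_mem fixTo_apply_of_not_mem)

/-! ## §1  `ℤ^d`: a comb-trivial configuration has trivial axial gauge function on the box -/

section GroupLevel

variable {d : ℕ} {G : Type*} [Group G]

/-- a straight segment of `n` forward steps all of whose bonds read `1` has trivial holonomy. [folklore] -/
theorem hol_seg_eq_one (V : (Fin d → ℤ) → Fin d → G) (z : Fin d → ℤ) (κ : Fin d) :
    ∀ n : ℕ, (∀ i : ℕ, i < n → V (z + (i : ℤ) • e κ) κ = 1) → hol V z (seg κ n) = 1
  | 0, _ => by simp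
  | n + 1, h => by
    rw [Nat.cast_succ, hol_seg_natCast_succ, hol_seg_eq_one V z κ n fun i hi => h i (Nat.lt_succ_of_lt hi),
      one_mul]
    exact h n (Nat.lt_succ_self n)

/-- **A TREE WORD ALL OF WHOSE BONDS ARE COMB BONDS READING `1` HAS TRIVIAL HOLONOMY.**  The comb condition relative to
the corner `lo` inside `[lo, hi]`: every bond `⟨w, μ⟩` with `lo ≤ w`, `w + e_μ ≤ hi`, `w_κ = lo_κ (κ < μ)` reads `1`.
Walking the coordinates of `0 ≤ v` (`lo + v ≤ hi`) in a strictly decreasing list of directions from a point `z` of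
the box that agrees with `lo` in every listed direction and below, one meets comb bonds only. [folklore] -/
theorem hol_tw_eq_one (V : (Fin d → ℤ) → Fin d → G) {lo hi : Fin d → ℤ}
    (hV : ∀ (w : Fin d → ℤ) (μ : Fin d), lo ≤ w → w + e μ ≤ hi → lowPart μ (w - lo) = 0 → V w μ = 1)
    {v : Fin d → ℤ} (hv : 0 ≤ v) (hvhi : lo + v ≤ hi) :
    ∀ (ks : List (Fin d)), ks.Pairwise (fun a b => b < a) → ∀ z : Fin d → ℤ, lo ≤ z → z ≤ lo + v →
      (∀ κ ∈ ks, ∀ κ', κ' ≤ κ → z κ' = lo κ') → hol V z (tw ks v) = 1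
  | [], _, z, _, _, _ => by simp
  | κ :: ks, hks, z, hz1, hz2, hz3 => by
    rw [tw_cons, hol_append, disp_seg]
    obtain ⟨n, hn⟩ := Int.eq_ofNat_of_zero_le (hv κ)
    have hκz : ∀ κ', κ' ≤ κ → z κ' = lo κ' := hz3 κ (by simp)
    have h1 : hol V z (seg κ (v κ)) = 1 := by
      rw [hn]
      refine hol_seg_eq_one V z κ n fun i hi => hV _ _ (fun κ' => ?_) (fun κ' => ?_) (funext fun κ' => ?_)
      · simp only [Pi.add_apply, zsmul_e_apply]
        have := hz1 κ'
        have hi0 : (0 : ℤ) ≤ (i : ℤ) := by positivity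
        split_ifs <;> linarith
      · simp only [Pi.add_apply, zsmul_e_apply, e_apply]
        have h2 := hz2 κ'
        have h3 := hvhi κ'
        simp only [Pi.add_apply] at h2 h3
        split_ifs with h
        · subst h
          have h4 := hκz κ' le_rfl
          have h5 : (i : ℤ) + 1 ≤ n := by exact_mod_cast hi
          rw [← hn] at h5
          linarith
        · linarith
      · simp only [lowPart_apply, Pi.sub_apply, Pi.add_apply, zsmul_e_apply, Pi.zero_apply]
        split_ifs with h h'
        · exact absurd (h' ▸ h) (lt_irrefl _)
        · rw [hκz κ' h.le]; ring
        · rfl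
    have hks' : ks.Pairwise (fun a b => b < a) := (List.pairwise_cons.1 hks).2
    have hlt : ∀ κ₁ ∈ ks, κ₁ < κ := (List.pairwise_cons.1 hks).1
    rw [h1, one_mul]
    refine hol_tw_eq_one V hV hv hvhi ks hks' (z + v κ • e κ) (fun κ' => ?_) (fun κ' => ?_)
      (fun κ₁ hκ₁ κ' hκ' => ?_)
    · simp only [Pi.add_apply, zsmul_e_apply]
      have := hz1 κ'; have := hv κ'
      split_ifs with h
      · subst h; linarith
      · linarith
    · simp only [Pi.add_apply, zsmul_e_apply]
      have h2 := hz2 κ'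
      simp only [Pi.add_apply] at h2
      split_ifs with h
      · subst h; rw [hκz κ' le_rfl]
      · linarith
    · have hκ'κ : κ' < κ := lt_of_le_of_lt hκ' (hlt κ₁ hκ₁)
      simp only [Pi.add_apply, zsmul_e_apply, if_neg hκ'κ.ne, add_zero]
      exact hκz κ' hκ'κ.le

/-- **THE AXIAL GAUGE FUNCTION OF A COMB-TRIVIAL CONFIGURATION IS TRIVIAL ON THE BOX**: `axialFn V lo x =
V(Γ_{lo,x}) = 1` for `lo ≤ x ≤ hi` — the tree contour walks comb bonds only. [folklore] -/
theorem axialFn_eq_one_of_comb (V : (Fin d → ℤ) → Fin d → G) {lo hi : Fin d → ℤ}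
    (hV : ∀ (w : Fin d → ℤ) (μ : Fin d), lo ≤ w → w + e μ ≤ hi → lowPart μ (w - lo) = 0 → V w μ = 1)
    {x : Fin d → ℤ} (hx : lo ≤ x) (hx' : x ≤ hi) : axialFn V lo x = 1 := by
  unfold axialFn
  rw [treeWord_eq_tw]
  exact hol_tw_eq_one V hV (v := x - lo) (sub_nonneg.2 hx) (by rw [add_sub_cancel]; exact hx') _
    (pairwise_gt_finRange_reverse d) lo le_rfl (by rw [add_sub_cancel]; exact hx) fun _ _ _ _ => rfl

/-- … hence the axial gauge does not move the box bonds of a comb-trivial configuration: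
`(V^{axialFn V lo})(x, x + e_μ) = V(x, x + e_μ)` for `lo ≤ x`, `x + e_μ ≤ hi`. [folklore] -/
theorem gaugeAct_axialFn_eq_self_of_comb (V : (Fin d → ℤ) → Fin d → G) {lo hi : Fin d → ℤ}
    (hV : ∀ (w : Fin d → ℤ) (μ : Fin d), lo ≤ w → w + e μ ≤ hi → lowPart μ (w - lo) = 0 → V w μ = 1)
    {x : Fin d → ℤ} {μ : Fin d} (hx : lo ≤ x) (hxμ : x + e μ ≤ hi) :
    gaugeAct (axialFn V lo) V x μ = V x μ := by
  have hx' : x ≤ hi := (le_add_of_nonneg_right (e_nonneg μ)).trans hxμ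
  have hlo' : lo ≤ x + e μ := hx.trans (le_add_of_nonneg_right (e_nonneg μ))
  unfold gaugeAct
  rw [axialFn_eq_one_of_comb V hV hx hx', axialFn_eq_one_of_comb V hV hlo' hxμ]
  simp

end GroupLevel

section GaugeGroupLevel

variable {d : ℕ} {G : Type*} [GaugeGroup G]

/-- **SHARP REACH, `ℤ^d`**: under the box plaquette hypothesis `BoxPlaqSmall V lo hi a` a COMB-TRIVIAL configuration
has `dist1 (V(x, x + e_μ)) ≤ (Σ_{κ<μ}|x_κ − lo_κ|)·a` for `lo ≤ x`, `x + e_μ ≤ hi`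
(`T4AxialGaugeSmallField.dist1_axial_bond_le_sharp` for the configuration itself). [folklore] -/
theorem dist1_le_sharp_of_comb (V : (Fin d → ℤ) → Fin d → G) {lo hi : Fin d → ℤ} {a : ℝ}
    (hP : BoxPlaqSmall V lo hi a)
    (hV : ∀ (w : Fin d → ℤ) (μ : Fin d), lo ≤ w → w + e μ ≤ hi → lowPart μ (w - lo) = 0 → V w μ = 1)
    {x : Fin d → ℤ} {μ : Fin d} (hx : lo ≤ x) (hxμ : x + e μ ≤ hi) :
    dist1 (V x μ) ≤ l1 (lowPart μ (x - lo)) * a := by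
  have h := dist1_axial_bond_le_sharp V hP lo x μ le_rfl hx hxμ
  rwa [gaugeAct_axialFn_eq_self_of_comb V hV hx hxμ] at h

/-- **UNIFORM REACH, `ℤ^d`**: for a box of `n + 1` sites per direction (`hi ≤ lo + n`), `0 ≤ a`, a comb-trivial
configuration with `BoxPlaqSmall V lo hi a` has `dist1 (V(x, x + e_μ)) ≤ (d − 1)·n·a` on every box bond. [folklore] -/
theorem dist1_le_uniform_of_comb (V : (Fin d → ℤ) → Fin d → G) {lo hi : Fin d → ℤ} {a : ℝ} {n : ℕ}
    (hP : BoxPlaqSmall V lo hi a) (ha : 0 ≤ a) (hn : ∀ κ, hi κ ≤ lo κ + n)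
    (hV : ∀ (w : Fin d → ℤ) (μ : Fin d), lo ≤ w → w + e μ ≤ hi → lowPart μ (w - lo) = 0 → V w μ = 1)
    {x : Fin d → ℤ} {μ : Fin d} (hx : lo ≤ x) (hxμ : x + e μ ≤ hi) :
    dist1 (V x μ) ≤ ((d - 1 : ℕ) : ℝ) * n * a := by
  have h := dist1_axial_bond_le_uniform V hP ha hn x μ hx hxμ
  rwa [gaugeAct_axialFn_eq_self_of_comb V hV hx hxμ] at h

end GaugeGroupLevel

/-! ## §2  Torus carrier: configurations equal to `1` on `combBonds lo hi` -/

section Torus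

variable {P : Params} {j : ℕ} {G : Type*} [GaugeGroup G]

/-- The periodic pullback of a configuration equal to `1` on the torus comb `combBonds lo hi` is comb-trivial on
`ℤ^d` (the definition of `T4AxialGaugeFixing.combSet`). [folklore] -/
theorem pull_eq_one_of_comb (U : GaugeField P j G) {lo hi : Fin P.d → ℤ}
    (hU : ∀ b ∈ (combBonds lo hi : Finset (PBond P j)), U b = 1) :
    ∀ (w : Fin P.d → ℤ) (μ : Fin P.d), lo ≤ w → w + e μ ≤ hi → lowPart μ (w - lo) = 0 → pull U w μ = 1 :=
  fun w μ h1 h2 h3 => hU ⟨castSite w, μ⟩ (mem_combBonds.2 ⟨w, h1, h2, rfl, h3⟩)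

/-- **REACH ON THE TORUS**: if `U = 1` on `combBonds lo hi` and `dist1 U(∂p) < a` on the box plaquettes
(`S₀ ⊇ boxPlaqs lo hi`), `0 ≤ a`, `hi ≤ lo + n`, then `dist1 (U⟨castSite x, μ⟩) ≤ (d − 1)·n·a` for `lo ≤ x`,
`x + e_μ ≤ hi`.  No non-wrapping hypothesis (the estimate runs on the periodic pullback). [folklore] -/
theorem dist1_le_of_comb (U : GaugeField P j G) {lo hi : Fin P.d → ℤ} {a : ℝ} {S₀ : Set (Plaq P j)} {n : ℕ}
    (hS₀ : boxPlaqs lo hi ⊆ S₀) (hUa : PlaqSmallOn S₀ a U) (ha : 0 ≤ a) (hn : ∀ κ, hi κ ≤ lo κ + n)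
    (hU : ∀ b ∈ (combBonds lo hi : Finset (PBond P j)), U b = 1)
    {x : Fin P.d → ℤ} {μ : Fin P.d} (hx : lo ≤ x) (hxμ : x + e μ ≤ hi) :
    dist1 (U ⟨castSite x, μ⟩) ≤ ((P.d - 1 : ℕ) : ℝ) * n * a := by
  have h := dist1_le_uniform_of_comb (pull U) (boxPlaqSmall_pull U hS₀ hUa) ha hn (pull_eq_one_of_comb U hU) hx hxμ
  rwa [pull_apply] at h

/-- The same for bonds given as elements of `boxBonds lo hi`. [folklore] -/
theorem dist1_le_of_comb_of_mem_boxBonds (U : GaugeField P j G) {lo hi : Fin P.d → ℤ} {a : ℝ}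
    {S₀ : Set (Plaq P j)} {n : ℕ} (hS₀ : boxPlaqs lo hi ⊆ S₀) (hUa : PlaqSmallOn S₀ a U) (ha : 0 ≤ a)
    (hn : ∀ κ, hi κ ≤ lo κ + n) (hU : ∀ b ∈ (combBonds lo hi : Finset (PBond P j)), U b = 1)
    {b : PBond P j} (hb : b ∈ boxBonds lo hi) :
    dist1 (U b) ≤ ((P.d - 1 : ℕ) : ℝ) * n * a := by
  obtain ⟨x, hx, hxμ, hsrc⟩ := hb
  obtain ⟨src, dir⟩ := b
  simp only at hsrc hxμ
  subst hsrc
  exact dist1_le_of_comb U hS₀ hUa ha hn hU hx hxμ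

variable [DecidableEq (PBond P j)]

/-- The substituted configuration `U[comb := 1]` of the tree gauge is comb-trivial. [folklore] -/
theorem fixTo_comb_eq_one (lo hi : Fin P.d → ℤ) (U : GaugeField P j G) :
    ∀ b ∈ (combBonds lo hi : Finset (PBond P j)), fixTo (combBonds lo hi) 1 U b = 1 :=
  fun b hb => by rw [fixTo_apply_of_mem hb]; rfl

/-- Reach for the substituted configuration: `dist1 (U[comb := 1] b) ≤ (d − 1)·n·a` on `boxBonds lo hi` as soon as the
box plaquettes OF THE SUBSTITUTED CONFIGURATION are `a`-small. [folklore] -/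
theorem dist1_fixTo_comb_le (U : GaugeField P j G) {lo hi : Fin P.d → ℤ} {a : ℝ} {S₀ : Set (Plaq P j)} {n : ℕ}
    (hS₀ : boxPlaqs lo hi ⊆ S₀) (hUa : PlaqSmallOn S₀ a (fixTo (combBonds lo hi) 1 U)) (ha : 0 ≤ a)
    (hn : ∀ κ, hi κ ≤ lo κ + n) {b : PBond P j} (hb : b ∈ boxBonds lo hi) :
    dist1 (fixTo (combBonds lo hi) 1 U b) ≤ ((P.d - 1 : ℕ) : ℝ) * n * a :=
  dist1_le_of_comb_of_mem_boxBonds _ hS₀ hUa ha hn (fixTo_comb_eq_one lo hi U) hb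

end Torus

/-! ## §3  `SU(2)`: the box bonds of a comb-trivial plaquette-small configuration lie in ONE exponential window -/

section Window

open T4CubeChartGnomonic (SU2)
open T4CubeChartExp (expWindow expWindowDensity)
open T4ExpWindowSmallField (mem_expWindow_of_dist1_le_linear expWindowDensity_eq_one_iff)

variable {P : Params} {j : ℕ}

/-- ONE BOND: comb-trivial + plaquette-small on the box + `(d − 1)·n·a ≤ 2S/π` (`0 ≤ S`, `0 ≤ a`, `hi ≤ lo + n`) put every
box bond OF THE CONFIGURATION ITSELF in `expWindow 1 S`. [folklore] -/
theorem mem_expWindow_of_comb (U : GaugeField P j SU2) {lo hi : Fin P.d → ℤ} {a S : ℝ} {S₀ : Set (Plaq P j)}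
    {n : ℕ} (hS₀ : boxPlaqs lo hi ⊆ S₀) (hUa : PlaqSmallOn S₀ a U) (ha : 0 ≤ a) (hn : ∀ κ, hi κ ≤ lo κ + n)
    (hU : ∀ b ∈ (combBonds lo hi : Finset (PBond P j)), U b = 1) (hS : 0 ≤ S)
    (hrad : ((P.d - 1 : ℕ) : ℝ) * n * a ≤ 2 * S / Real.pi) {b : PBond P j} (hb : b ∈ boxBonds lo hi) :
    U b ∈ expWindow 1 S :=
  mem_expWindow_of_dist1_le_linear hS
    (by rw [inv_one, one_mul]; exact (dist1_le_of_comb_of_mem_boxBonds U hS₀ hUa ha hn hU hb).trans hrad)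

/-- **DENSITY FORM**: under the same hypotheses the product exponential window about the trivial configuration over
any finite set `s` of box bonds takes the value `1` AT THE CONFIGURATION ITSELF: `expWindowDensity s 1 S U = 1`.
[folklore] -/
theorem expWindowDensity_eq_one_of_comb (U : GaugeField P j SU2) {lo hi : Fin P.d → ℤ} {a S : ℝ}
    {S₀ : Set (Plaq P j)} {n : ℕ} (hS₀ : boxPlaqs lo hi ⊆ S₀) (hUa : PlaqSmallOn S₀ a U) (ha : 0 ≤ a)
    (hn : ∀ κ, hi κ ≤ lo κ + n) (hU : ∀ b ∈ (combBonds lo hi : Finset (PBond P j)), U b = 1) (hS : 0 ≤ S)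
    (hrad : ((P.d - 1 : ℕ) : ℝ) * n * a ≤ 2 * S / Real.pi) {s : Finset (PBond P j)}
    (hs : ∀ b ∈ s, b ∈ boxBonds lo hi) :
    expWindowDensity s 1 S U = 1 :=
  expWindowDensity_eq_one_iff.2 fun b hb => mem_expWindow_of_comb U hS₀ hUa ha hn hU hS hrad (hs b hb)

variable [DecidableEq (PBond P j)]

/-- **(LR)₀ FOR THE TREE-GAUGE SUBSTITUTION**: if the box plaquettes of `U[comb := 1]` are `a`-small, then
`expWindowDensity s 1 S (U[comb := 1]) = 1` for every finite set `s` of box bonds (`0 ≤ a`, `0 ≤ S`, `hi ≤ lo + n`,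
`(d − 1)·n·a ≤ 2S/π`) — the bond window of the realized (M1)₀ is IMPLIED by plaquette smallness after the tree gauge.
[folklore] -/
theorem expWindowDensity_fixTo_comb_eq_one (U : GaugeField P j SU2) {lo hi : Fin P.d → ℤ} {a S : ℝ}
    {S₀ : Set (Plaq P j)} {n : ℕ} (hS₀ : boxPlaqs lo hi ⊆ S₀)
    (hUa : PlaqSmallOn S₀ a (fixTo (combBonds lo hi) 1 U)) (ha : 0 ≤ a) (hn : ∀ κ, hi κ ≤ lo κ + n)
    (hS : 0 ≤ S) (hrad : ((P.d - 1 : ℕ) : ℝ) * n * a ≤ 2 * S / Real.pi) {s : Finset (PBond P j)}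
    (hs : ∀ b ∈ s, b ∈ boxBonds lo hi) :
    expWindowDensity s 1 S (fixTo (combBonds lo hi) 1 U) = 1 :=
  expWindowDensity_eq_one_of_comb _ hS₀ hUa ha hn (fixTo_comb_eq_one lo hi U) hS hrad hs

end Window

end Summit.QuantumFields.BalabanUV.T4Continuum.ShellMeasureAxialReach
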